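import Literature.NumberTheory.LFunctions.LevinsonCoincidenceSums
import Mathlib.Analysis.SpecialFunctions.Pow.Real
import HarnessLib

/-!
# Node weights of `ζ`-mollified combs, VIII: main terms against a difference of two weights

Topic `Literature/NumberTheory/LFunctions`.  In the node evaluation of `ζ`-mollified combs
(`Literature/NumberTheory/LFunctions/WeilCombNodeWeightsNode.lean`) the SMOOTH main term
`∑_n f(n) N(n)` and the DIAGONAL main term `∑_n f(n) D(n)/n` are each one logarithm larger than
what the comb inequality can afford; but for the DIFFERENCE `d = c - Λ` of two weights with
`|∑_{n ≤ N} d(n)/n| ≤ T₀` ("Mertens for both") and `∑_{n ≤ N} |d(n)| ≤ A'N` (Chebyshev) they are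
small:

* `abs_sum_mul_floor_div_le` — `|∑_{n ≤ N} d(n) ⌊X/n⌋| ≤ (T₀ + A') X`;
* `abs_sum_mul_min_floor_le` — `|∑_{n ≤ N} d(n) min(M, ⌊X/n⌋)| ≤ (2T₀ + 3A') X`;
* `abs_sum_div_mul_harmonic_floor_le` — `|∑_{n ≤ N} (d(n)/n) H(⌊X/n⌋)| ≤ T₀ (1 + log X)`
  (`H(m) = ∑_{k ≤ m} 1/k`; exchange of summation);
* `sum_ite_dvd_inv_eq` — `∑_{k ≤ K, p ∣ k} 1/k = (1/p) H(K/p)`;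
* `log_le_sum_inv_Icc_floor` — `log x ≤ H(⌊x⌋)` (Mathlib); `H(N) ≤ 1 + log N` is
  `Literature.NumberTheory.LFunctions.LevinsonSums.sum_Icc_one_div_le`
  (`Literature/NumberTheory/LFunctions/LevinsonCoincidenceSums.lean`).

Everything is proved; no named facts.
-/

noncomputable section

open Set

namespace Literature.NumberTheory.LFunctions

/-! ## Harmonic sums -/

/-- `log x ≤ ∑_{i ≤ ⌊x⌋} 1/i` for `x ≥ 0` (Mathlib's `log_le_harmonic_floor`). [folklore] -/
theorem log_le_sum_inv_Icc_floor {x : ℝ} (hx : 0 ≤ x) :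
    Real.log x ≤ ∑ i ∈ Finset.Icc 1 ⌊x⌋₊, (1 : ℝ) / i := by
  have h := log_le_harmonic_floor x hx
  rw [harmonic_eq_sum_Icc] at h
  push_cast at h
  simpa only [one_div] using h

section Difference

variable {d : ℕ → ℝ} {T₀ A' : ℝ}

/-- `T₀ ≥ 0` and `A' ≥ 0` follow from the hypotheses at `N = 0, 1`. [folklore] -/
theorem diff_consts_nonneg (hT : ∀ N : ℕ, |∑ n ∈ Finset.Icc 1 N, d n / n| ≤ T₀)
    (hA' : ∀ N : ℕ, ∑ n ∈ Finset.Icc 1 N, |d n| ≤ A' * N) : 0 ≤ T₀ ∧ 0 ≤ A' := by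
  constructor
  · exact (abs_nonneg _).trans (hT 0)
  · have := hA' 1
    simp only [Finset.Icc_self, Finset.sum_singleton, Nat.cast_one, mul_one] at this
    exact (abs_nonneg _).trans this

/-- **`|∑_{n ≤ N} d(n)⌊X/n⌋| ≤ (T₀ + A')X`**: write `⌊X/n⌋ = X/n - {X/n}`; the first part is
`X ∑ d(n)/n`, the second is at most `∑_{n ≤ X} |d(n)|`. [folklore] -/
theorem abs_sum_mul_floor_div_le (hT : ∀ N : ℕ, |∑ n ∈ Finset.Icc 1 N, d n / n| ≤ T₀)
    (hA' : ∀ N : ℕ, ∑ n ∈ Finset.Icc 1 N, |d n| ≤ A' * N) {X : ℝ} (hX : 0 ≤ X) (N : ℕ) :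
    |∑ n ∈ Finset.Icc 1 N, d n * (⌊X / n⌋₊ : ℝ)| ≤ (T₀ + A') * X := by
  obtain ⟨hT0, hA0⟩ := diff_consts_nonneg hT hA'
  -- restrict to `n ≤ N' = min N ⌊X⌋`
  set N' : ℕ := min N ⌊X⌋₊ with hN'
  have hvan : ∀ n ∈ Finset.Icc 1 N, n ∉ Finset.Icc 1 N' → d n * (⌊X / n⌋₊ : ℝ) = 0 := by
    intro n hn hn'
    simp only [Finset.mem_Icc, not_and_or, not_le] at hn hn'
    have hnX : ⌊X⌋₊ < n := by
      rcases hn' with h | h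
      · omega
      · rcases le_total N ⌊X⌋₊ with h2 | h2
        · rw [hN', min_eq_left h2] at h; omega
        · rw [hN', min_eq_right h2] at h; exact h
    have hn0 : (0 : ℝ) < n := by exact_mod_cast hn.1
    have : X / n < 1 := by
      rw [div_lt_one hn0]
      have := Nat.lt_of_floor_lt hnX
      exact this
    rw [Nat.floor_eq_zero.2 this, Nat.cast_zero, mul_zero]
  have hsub : Finset.Icc 1 N' ⊆ Finset.Icc 1 N := Finset.Icc_subset_Icc le_rfl (min_le_left _ _)
  rw [← Finset.sum_subset hsub hvan]
  -- on `n ≤ N'`: `⌊X/n⌋ = X/n - r_n`, `0 ≤ r_n < 1`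
  have hdecomp : ∑ n ∈ Finset.Icc 1 N', d n * (⌊X / n⌋₊ : ℝ)
      = X * ∑ n ∈ Finset.Icc 1 N', d n / n - ∑ n ∈ Finset.Icc 1 N', d n * (X / n - ⌊X / n⌋₊) := by
    rw [Finset.mul_sum, ← Finset.sum_sub_distrib]
    refine Finset.sum_congr rfl fun n _ ↦ by ring
  rw [hdecomp]
  have h1 : |X * ∑ n ∈ Finset.Icc 1 N', d n / n| ≤ T₀ * X := by
    rw [abs_mul, abs_of_nonneg hX, mul_comm]
    exact mul_le_mul_of_nonneg_right (hT N') hX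
  have h2 : |∑ n ∈ Finset.Icc 1 N', d n * (X / n - ⌊X / n⌋₊)| ≤ A' * X := by
    calc |∑ n ∈ Finset.Icc 1 N', d n * (X / n - ⌊X / n⌋₊)|
        ≤ ∑ n ∈ Finset.Icc 1 N', |d n * (X / n - ⌊X / n⌋₊)| := Finset.abs_sum_le_sum_abs _ _
      _ ≤ ∑ n ∈ Finset.Icc 1 N', |d n| := by
          refine Finset.sum_le_sum fun n hn ↦ ?_
          have hn0 : (0 : ℝ) < n := by exact_mod_cast (Finset.mem_Icc.1 hn).1
          have hr0 : 0 ≤ X / n - ⌊X / n⌋₊ := sub_nonneg.2 (Nat.floor_le (by positivity))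
          have hr1 : X / n - ⌊X / n⌋₊ ≤ 1 := by linarith [Nat.lt_floor_add_one (X / n)]
          rw [abs_mul, abs_of_nonneg hr0]
          exact mul_le_of_le_one_right (abs_nonneg _) hr1
      _ ≤ A' * N' := hA' N'
      _ ≤ A' * X := by
          refine mul_le_mul_of_nonneg_left ?_ hA0
          calc (N' : ℝ) ≤ ⌊X⌋₊ := by exact_mod_cast min_le_right _ _
            _ ≤ X := Nat.floor_le hX
  calc |X * ∑ n ∈ Finset.Icc 1 N', d n / n - ∑ n ∈ Finset.Icc 1 N', d n * (X / n - ⌊X / n⌋₊)|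
      ≤ |X * ∑ n ∈ Finset.Icc 1 N', d n / n| + |∑ n ∈ Finset.Icc 1 N', d n * (X / n - ⌊X / n⌋₊)| :=
        abs_sub _ _
    _ ≤ T₀ * X + A' * X := add_le_add h1 h2
    _ = (T₀ + A') * X := by ring

/-- **`|∑_{n ≤ N} d(n) min(M, ⌊X/n⌋)| ≤ (2T₀ + 3A')X`** (`M ≥ 1`): the minimum is `M` exactly for
`n ≤ X/M`, where `|M ∑_{n ≤ X/M} d(n)| ≤ A'X`, and the rest is a difference of two sums of the
previous kind. [folklore] -/
theorem abs_sum_mul_min_floor_le (hT : ∀ N : ℕ, |∑ n ∈ Finset.Icc 1 N, d n / n| ≤ T₀)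
    (hA' : ∀ N : ℕ, ∑ n ∈ Finset.Icc 1 N, |d n| ≤ A' * N) {X : ℝ} (hX : 0 ≤ X) {M : ℕ}
    (hM : 1 ≤ M) (N : ℕ) :
    |∑ n ∈ Finset.Icc 1 N, d n * ((min M ⌊X / n⌋₊ : ℕ) : ℝ)| ≤ (2 * T₀ + 3 * A') * X := by
  obtain ⟨hT0, hA0⟩ := diff_consts_nonneg hT hA'
  have hMR : (1 : ℝ) ≤ M := by exact_mod_cast hM
  have hM0 : (0 : ℝ) < M := by linarith
  set Y : ℝ := X / M with hY
  have hY0 : 0 ≤ Y := by positivity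
  set N' : ℕ := min N ⌊Y⌋₊ with hN'
  have hN'N : N' ≤ N := min_le_left _ _
  have hIcc : Finset.Icc 1 N = Finset.Ioc 0 N := by
    ext k; simp only [Finset.mem_Icc, Finset.mem_Ioc]; omega
  have hIcc' : Finset.Icc 1 N' = Finset.Ioc 0 N' := by
    ext k; simp only [Finset.mem_Icc, Finset.mem_Ioc]; omega
  -- split at `N'`
  have hsplit : ∑ n ∈ Finset.Icc 1 N, d n * ((min M ⌊X / n⌋₊ : ℕ) : ℝ)
      = ∑ n ∈ Finset.Icc 1 N', d n * ((min M ⌊X / n⌋₊ : ℕ) : ℝ)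
        + ∑ n ∈ Finset.Ioc N' N, d n * ((min M ⌊X / n⌋₊ : ℕ) : ℝ) := by
    rw [hIcc, hIcc', Finset.sum_Ioc_consecutive _ (Nat.zero_le _) hN'N]
  -- first block: the minimum is `M`
  have hfirst : ∑ n ∈ Finset.Icc 1 N', d n * ((min M ⌊X / n⌋₊ : ℕ) : ℝ)
      = M * ∑ n ∈ Finset.Icc 1 N', d n := by
    rw [Finset.mul_sum]
    refine Finset.sum_congr rfl fun n hn ↦ ?_
    obtain ⟨hn1, hnN'⟩ := Finset.mem_Icc.1 hn
    have hn0 : (0 : ℝ) < n := by exact_mod_cast hn1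
    have hnY : (n : ℝ) ≤ Y := le_trans (by exact_mod_cast hnN'.trans (min_le_right _ _)) (Nat.floor_le hY0)
    have hMle : M ≤ ⌊X / n⌋₊ := by
      apply Nat.le_floor
      rw [le_div_iff₀ hn0]
      calc (M : ℝ) * n ≤ M * Y := mul_le_mul_of_nonneg_left hnY hM0.le
        _ = X := by rw [hY]; field_simp
    rw [min_eq_left hMle, mul_comm]
  -- second block: the minimum is `⌊X/n⌋`
  have hsecond : ∑ n ∈ Finset.Ioc N' N, d n * ((min M ⌊X / n⌋₊ : ℕ) : ℝ)
      = ∑ n ∈ Finset.Ioc N' N, d n * (⌊X / n⌋₊ : ℝ) := by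
    refine Finset.sum_congr rfl fun n hn ↦ ?_
    obtain ⟨hnN', hnN⟩ := Finset.mem_Ioc.1 hn
    -- here `N' = ⌊Y⌋ < n`
    have hN'eq : N' = ⌊Y⌋₊ := by
      rcases le_total N ⌊Y⌋₊ with h | h
      · exfalso; rw [hN', min_eq_left h] at hnN'; omega
      · rw [hN', min_eq_right h]
    rw [hN'eq] at hnN'
    have hnY : Y < n := by
      have := Nat.lt_floor_add_one Y
      have h2 : (⌊Y⌋₊ : ℝ) + 1 ≤ n := by exact_mod_cast hnN'
      linarith
    have hn0 : (0 : ℝ) < n := lt_of_le_of_lt hY0 hnY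
    have hle : ⌊X / n⌋₊ ≤ M := by
      have : X / n ≤ M := by
        rw [div_le_iff₀ hn0]
        calc X = M * Y := by rw [hY]; field_simp
          _ ≤ M * n := mul_le_mul_of_nonneg_left hnY.le hM0.le
      have h3 : (⌊X / n⌋₊ : ℝ) ≤ M := (Nat.floor_le (by positivity)).trans this
      exact_mod_cast h3
    rw [min_eq_right hle]
  have hsecond' : ∑ n ∈ Finset.Ioc N' N, d n * (⌊X / n⌋₊ : ℝ)
      = ∑ n ∈ Finset.Icc 1 N, d n * (⌊X / n⌋₊ : ℝ) - ∑ n ∈ Finset.Icc 1 N', d n * (⌊X / n⌋₊ : ℝ) := by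
    rw [hIcc, hIcc', ← Finset.sum_Ioc_consecutive _ (Nat.zero_le _) hN'N]; ring
  rw [hsplit, hfirst, hsecond, hsecond']
  have b1 : |(M : ℝ) * ∑ n ∈ Finset.Icc 1 N', d n| ≤ A' * X := by
    rw [abs_mul, abs_of_pos hM0]
    calc (M : ℝ) * |∑ n ∈ Finset.Icc 1 N', d n| ≤ M * ∑ n ∈ Finset.Icc 1 N', |d n| :=
          mul_le_mul_of_nonneg_left (Finset.abs_sum_le_sum_abs _ _) hM0.le
      _ ≤ M * (A' * N') := mul_le_mul_of_nonneg_left (hA' N') hM0.le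
      _ ≤ M * (A' * Y) := by
          refine mul_le_mul_of_nonneg_left (mul_le_mul_of_nonneg_left ?_ hA0) hM0.le
          exact le_trans (by exact_mod_cast min_le_right _ _) (Nat.floor_le hY0)
      _ = A' * X := by rw [hY]; field_simp
  have b2 := abs_sum_mul_floor_div_le hT hA' hX N
  have b3 := abs_sum_mul_floor_div_le hT hA' hX N'
  calc |(M : ℝ) * ∑ n ∈ Finset.Icc 1 N', d n
        + (∑ n ∈ Finset.Icc 1 N, d n * (⌊X / n⌋₊ : ℝ) - ∑ n ∈ Finset.Icc 1 N', d n * (⌊X / n⌋₊ : ℝ))|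
      ≤ |(M : ℝ) * ∑ n ∈ Finset.Icc 1 N', d n|
        + (|∑ n ∈ Finset.Icc 1 N, d n * (⌊X / n⌋₊ : ℝ)| + |∑ n ∈ Finset.Icc 1 N', d n * (⌊X / n⌋₊ : ℝ)|) :=
        (abs_add_le _ _).trans (add_le_add le_rfl (abs_sub _ _))
    _ ≤ A' * X + ((T₀ + A') * X + (T₀ + A') * X) := add_le_add b1 (add_le_add b2 b3)
    _ = (2 * T₀ + 3 * A') * X := by ring

/-- **Exchange of summation for the diagonal main term**: for `X ≥ 1`,
`|∑_{n ≤ N} (d(n)/n) ∑_{k ≤ ⌊X/n⌋} 1/k| ≤ T₀ (1 + log X)`, since the double sum is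
`∑_{k ≤ X} (1/k) ∑_{n ≤ min(N, X/k)} d(n)/n`. [folklore] -/
theorem abs_sum_div_mul_harmonic_floor_le (hT : ∀ N : ℕ, |∑ n ∈ Finset.Icc 1 N, d n / n| ≤ T₀)
    {X : ℝ} (hX : 1 ≤ X) (N : ℕ) :
    |∑ n ∈ Finset.Icc 1 N, d n / n * ∑ k ∈ Finset.Icc 1 ⌊X / n⌋₊, (1 : ℝ) / k|
      ≤ T₀ * (1 + Real.log X) := by
  have hT0 : 0 ≤ T₀ := (abs_nonneg _).trans (hT 0)
  have hX0 : 0 < X := by linarith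
  -- exchange
  have hex : ∑ n ∈ Finset.Icc 1 N, d n / n * ∑ k ∈ Finset.Icc 1 ⌊X / n⌋₊, (1 : ℝ) / k
      = ∑ k ∈ Finset.Icc 1 ⌊X⌋₊, ∑ n ∈ Finset.Icc 1 (min N ⌊X / k⌋₊), d n / n * ((1 : ℝ) / k) := by
    simp_rw [Finset.mul_sum]
    refine Finset.sum_comm' fun n k ↦ ?_
    simp only [Finset.mem_Icc, le_min_iff]
    constructor
    · rintro ⟨⟨hn1, hnN⟩, hk1, hkX⟩
      have hn0 : (0 : ℝ) < n := by exact_mod_cast hn1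
      have hk0 : (0 : ℝ) < k := by exact_mod_cast hk1
      have hkle : (k : ℝ) ≤ X / n := le_trans (by exact_mod_cast hkX) (Nat.floor_le (by positivity))
      have hnk : n ≤ ⌊X / k⌋₊ := by
        apply Nat.le_floor
        rw [le_div_iff₀ hk0]
        rw [le_div_iff₀ hn0] at hkle
        linarith
      have hkX' : k ≤ ⌊X⌋₊ := by
        apply Nat.le_floor
        calc (k : ℝ) ≤ X / n := hkle
          _ ≤ X := div_le_self hX0.le (by exact_mod_cast hn1)
      exact ⟨⟨hn1, hnN, hnk⟩, hk1, hkX'⟩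
    · rintro ⟨⟨hn1, hnN, hnk⟩, hk1, hkX⟩
      have hn0 : (0 : ℝ) < n := by exact_mod_cast hn1
      have hk0 : (0 : ℝ) < k := by exact_mod_cast hk1
      have hnle : (n : ℝ) ≤ X / k := le_trans (by exact_mod_cast hnk) (Nat.floor_le (by positivity))
      have hkn : k ≤ ⌊X / n⌋₊ := by
        apply Nat.le_floor
        rw [le_div_iff₀ hn0]
        rw [le_div_iff₀ hk0] at hnle
        linarith
      exact ⟨⟨hn1, hnN⟩, hk1, hkn⟩
  rw [hex]
  have hmul : ∀ n k : ℕ, d n / n * ((1 : ℝ) / k) = (1 : ℝ) / k * (d n / n) := fun n k ↦ mul_comm _ _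
  calc |∑ k ∈ Finset.Icc 1 ⌊X⌋₊, ∑ n ∈ Finset.Icc 1 (min N ⌊X / k⌋₊), d n / n * ((1 : ℝ) / k)|
      = |∑ k ∈ Finset.Icc 1 ⌊X⌋₊, (1 : ℝ) / k * ∑ n ∈ Finset.Icc 1 (min N ⌊X / k⌋₊), d n / n| := by
        congr 1
        refine Finset.sum_congr rfl fun k _ ↦ ?_
        rw [Finset.mul_sum]
        refine Finset.sum_congr rfl fun n _ ↦ hmul n k
    _ ≤ ∑ k ∈ Finset.Icc 1 ⌊X⌋₊, |(1 : ℝ) / k * ∑ n ∈ Finset.Icc 1 (min N ⌊X / k⌋₊), d n / n| :=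
        Finset.abs_sum_le_sum_abs _ _
    _ ≤ ∑ k ∈ Finset.Icc 1 ⌊X⌋₊, (1 : ℝ) / k * T₀ := by
        refine Finset.sum_le_sum fun k hk ↦ ?_
        have hk0 : (0 : ℝ) < k := by exact_mod_cast (Finset.mem_Icc.1 hk).1
        rw [abs_mul, abs_of_pos (by positivity)]
        exact mul_le_mul_of_nonneg_left (hT _) (by positivity)
    _ = T₀ * ∑ k ∈ Finset.Icc 1 ⌊X⌋₊, (1 : ℝ) / k := by rw [← Finset.sum_mul, mul_comm]
    _ ≤ T₀ * (1 + Real.log X) := by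
        refine mul_le_mul_of_nonneg_left ?_ hT0
        have h1 := LevinsonSums.sum_Icc_one_div_le ⌊X⌋₊
        have h2 : Real.log (⌊X⌋₊ : ℕ) ≤ Real.log X :=
          Real.log_le_log (by exact_mod_cast Nat.floor_pos.2 hX) (Nat.floor_le hX0.le)
        linarith

end Difference

/-! ## Harmonic sums over a progression -/

/-- `∑_{k ≤ K, p ∣ k} 1/k = (1/p) ∑_{j ≤ K/p} 1/j` for `p ≥ 1` (the multiples of `p` in `[1, K]` are
the `pj`, `j ≤ K/p`: `Literature.NumberTheory.LFunctions.LevinsonSums.filter_dvd_Icc_eq_image`). [folklore] -/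
theorem sum_ite_dvd_inv_eq {p : ℕ} (hp : 1 ≤ p) (K : ℕ) :
    ∑ k ∈ Finset.Icc 1 K, (if p ∣ k then (1 : ℝ) / k else 0)
      = 1 / (p : ℝ) * ∑ j ∈ Finset.Icc 1 (K / p), (1 : ℝ) / j := by
  rw [← Finset.sum_filter]
  rw [LevinsonSums.filter_dvd_Icc_eq_image hp, Finset.sum_image (fun j _ j' _ h ↦ Nat.eq_of_mul_eq_mul_left hp h),
    Finset.mul_sum]
  refine Finset.sum_congr rfl fun j hj ↦ ?_
  have hp0 : (p : ℝ) ≠ 0 := by exact_mod_cast (by omega : p ≠ 0)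
  have hj0 : (j : ℝ) ≠ 0 := by exact_mod_cast (by have := (Finset.mem_Icc.1 hj).1; omega : j ≠ 0)
  push_cast
  field_simp

end Literature.NumberTheory.LFunctions
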